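import Mathlib
import Summits.ValiantsHypothesis.ValiantsHypothesis.Theorems.TwoProducts.Negative.CommonPadding
import Summits.ValiantsHypothesis.ValiantsHypothesis.Theorems.TwoProducts.Negative.FullPadding
import Summits.ValiantsHypothesis.ValiantsHypothesis.Theorems.TwoProducts.Negative.FullPaddingThresholds
import Summits.ValiantsHypothesis.ValiantsHypothesis.Theorems.TwoProducts.Negative.FullPaddingResidual
import Summits.ValiantsHypothesis.ValiantsHypothesis.Theorems.TwoProducts.Negative.TowerPadding
import HarnessLib

/-!
# NEGATIVE lane (val-neg-1 g5): after the R10 rung `ConfinedTameLaw C`, the residual of `relation_ladder` is again `PlanarCellBound`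

Helper file for crux `stmt-ValiantsHypothesis-5906` (filed `--supports`; closes NO item, proves NO summit statement, does NOT prove
`TwoProducts`, `PlanarCellBound`, any `ResidualLawV…`, `ConfinedTameLaw` or VP ≠ VNP; 0 `def`s).  Sequel to `Negative/TowerPadding.lean`,
`Negative/FullPadding*.lean` (same seat).

`planarCellBound_of_residualNotTame (C)`: the law «v21 residual hypotheses ((R5), (R1_r), no rank-one datum) AND the family is NOT confined-tame at
level `C` (for every `L` with `#L ≤ C·m` confining the coincidences, the fibre-spread bound `(m+2)^C` fails — val-idea-37's `LetterConfined` /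
`FibreSpread`, texts verbatim with `toZ`/`InSat`/`relLattice`/`realisedDiffs` unfolded) ⇒ cells small» implies `PlanarCellBound` (text verbatim), with
`(a, b) ↦ (a(18C+27), b + a(1152C + 1216 + 18(C+1)(C+36)))`; `residualNotTame_iff_planarCellBound`: they are equivalent as `∃ a b` laws.
Construction: common binary TOWER padding (`H = (C+1)(m + 32(L+1) + 36 + C)` pairs `X^{2^{i+1}s} + X^{2^{i+2}s}`, `L = ⌊log₂(t+2)⌋`) followed by the
full base-5 padding of `FullPaddingResidual`; the tower survives in the final family and kills every fibre-spread bound `< 2^H`, in particular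
`(m'+2)^C`.  READING: the R10 rung (a genuine proper sub-law — its class is not reachable by padding) excises nothing from the residual LAW; after it
the line still owes `PlanarCellBound` in full.  [folklore]
-/

namespace Summit.ValiantsHypothesis.Theorems.TwoProducts.Negative.TowerPaddingResidual

open Finset MvPolynomial
open Summit.ValiantsHypothesis.ValiantsHypothesis.Theorems.NewtonUnitEquations.TwoProducts.FormalLogLinearisation
open Summit.ValiantsHypothesis.ValiantsHypothesis.Theorems.NewtonUnitEquations.TwoProducts.PlanarCell
open Summit.ValiantsHypothesis.ValiantsHypothesis.Theorems.NewtonUnitEquations.TwoProducts.PermutationType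
  (msetT PermType RankOneCoincidences)
open Summit.ValiantsHypothesis.Theorems.TwoProducts.Negative.CommonPadding
open Summit.ValiantsHypothesis.Theorems.TwoProducts.Negative.FullPadding (fullPadding_spec fullPadding_letters fullPadding_noDatum)
open Summit.ValiantsHypothesis.Theorems.TwoProducts.Negative.FullPaddingThresholds (fullPadding_noSmallPermMerge fullPadding_noCheapCover)
open Summit.ValiantsHypothesis.Theorems.TwoProducts.Negative.FullPaddingResidual (fullPadding_condition)
open Summit.ValiantsHypothesis.Theorems.TwoProducts.Negative.TowerPadding

/-! ### Arithmetic of the tower -/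

/-- `27 n² < 2^n` for `n ≥ 15`. [folklore] -/
theorem aux_sq_lt_two_pow : ∀ n : ℕ, 15 ≤ n → 27 * n * n < 2 ^ n := by
  intro n hn
  induction n, hn using Nat.le_induction with
  | base => norm_num
  | succ n hn ih =>
    have h1 : 27 * (n + 1) * (n + 1) ≤ 2 * (27 * n * n) := by nlinarith
    calc 27 * (n + 1) * (n + 1) ≤ 2 * (27 * n * n) := h1
      _ < 2 * 2 ^ n := by linarith
      _ = 2 ^ (n + 1) := by rw [pow_succ]; ring

/-- **Tower threshold**: the final fibre-spread level `(m' + 2)^C` is below the tower mass `2^H`. [folklore] -/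
theorem tower_threshold {m C Lg z₀ H m₁ k : ℕ} (hz : z₀ = m + 32 * (Lg + 1) + 36 + C) (hH : H = (C + 1) * z₀) (hm₁ : m₁ = m + (H + H))
    (hk : k = m₁ + 4 * (Lg + 1)) : (m₁ + (4 * k + 4 * k) + 2) ^ C < 2 ^ H := by
  have hz15 : 15 ≤ z₀ := by omega
  have hCz : C + 1 ≤ z₀ := by omega
  have hN : m₁ + (4 * k + 4 * k) + 2 ≤ 27 * ((C + 1) * z₀) := by
    have h1 : m₁ + (4 * k + 4 * k) + 2 = 9 * m + 18 * H + 32 * Lg + 34 := by omega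
    have h2 : 9 * m + 32 * Lg + 34 ≤ 9 * z₀ := by omega
    have h3 : z₀ ≤ (C + 1) * z₀ := Nat.le_mul_of_pos_left z₀ (Nat.succ_pos C)
    rw [h1, hH]
    linarith
  have hlt : 27 * ((C + 1) * z₀) < 2 ^ z₀ :=
    calc 27 * ((C + 1) * z₀) ≤ 27 * (z₀ * z₀) := Nat.mul_le_mul_left _ (Nat.mul_le_mul_right _ hCz)
      _ = 27 * z₀ * z₀ := by ring
      _ < 2 ^ z₀ := aux_sq_lt_two_pow z₀ hz15
  have hNle : m₁ + (4 * k + 4 * k) + 2 ≤ 2 ^ z₀ := (hN.trans_lt hlt).le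
  calc (m₁ + (4 * k + 4 * k) + 2) ^ C ≤ (2 ^ z₀) ^ C := Nat.pow_le_pow_left hNle C
    _ = 2 ^ (z₀ * C) := by rw [← pow_mul]
    _ < 2 ^ (z₀ * C + z₀) := Nat.pow_lt_pow_right (by norm_num) (by omega)
    _ = 2 ^ H := by rw [hH]; ring_nf

/-- **Tower cost**: the law on `m' = (18C+27)m + (576C+608)(L+1) + 18(C+1)(C+36)` positions, read back on `m` positions. [folklore] -/
theorem tower_cost {m t C Lg z₀ H m₁ k : ℕ} (a b : ℕ) (hz : z₀ = m + 32 * (Lg + 1) + 36 + C) (hH : H = (C + 1) * z₀)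
    (hm₁ : m₁ = m + (H + H)) (hk : k = m₁ + 4 * (Lg + 1)) (hL : 2 ^ Lg ≤ t + 2) (ht : 2 ≤ t + 2) :
    2 ^ (a * (m₁ + (4 * k + 4 * k))) * (t + 2) ^ b ≤
      2 ^ (a * (18 * C + 27) * m) * (t + 2) ^ (b + a * (2 * (576 * C + 608) + 18 * (C + 1) * (C + 36))) := by
  have hm' : a * (m₁ + (4 * k + 4 * k)) =
      a * (18 * C + 27) * m + (Lg + 1) * (a * (576 * C + 608)) + a * (18 * (C + 1) * (C + 36)) := by
    subst hk hm₁ hH hz; ring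
  have h2L : 2 ^ (Lg + 1) ≤ (t + 2) ^ 2 :=
    calc 2 ^ (Lg + 1) = 2 ^ Lg * 2 := pow_succ _ _
      _ ≤ (t + 2) * (t + 2) := Nat.mul_le_mul hL ht
      _ = (t + 2) ^ 2 := (sq _).symm
  have hA : 2 ^ ((Lg + 1) * (a * (576 * C + 608))) ≤ (t + 2) ^ (2 * (a * (576 * C + 608))) := by
    rw [pow_mul 2 (Lg + 1), pow_mul (t + 2) 2]
    exact Nat.pow_le_pow_left h2L _
  have hB : 2 ^ (a * (18 * (C + 1) * (C + 36))) ≤ (t + 2) ^ (a * (18 * (C + 1) * (C + 36))) := Nat.pow_le_pow_left ht _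
  have hsplit : (t + 2) ^ (b + a * (2 * (576 * C + 608) + 18 * (C + 1) * (C + 36))) =
      (t + 2) ^ b * ((t + 2) ^ (2 * (a * (576 * C + 608))) * (t + 2) ^ (a * (18 * (C + 1) * (C + 36)))) := by
    rw [← pow_add, ← pow_add]; congr 1; ring
  rw [hm', pow_add, pow_add, hsplit]
  calc 2 ^ (a * (18 * C + 27) * m) * 2 ^ ((Lg + 1) * (a * (576 * C + 608))) * 2 ^ (a * (18 * (C + 1) * (C + 36))) * (t + 2) ^ b
      = 2 ^ (a * (18 * C + 27) * m) * ((t + 2) ^ b *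
          (2 ^ ((Lg + 1) * (a * (576 * C + 608))) * 2 ^ (a * (18 * (C + 1) * (C + 36))))) := by ring
    _ ≤ 2 ^ (a * (18 * C + 27) * m) * ((t + 2) ^ b *
          ((t + 2) ^ (2 * (a * (576 * C + 608))) * (t + 2) ^ (a * (18 * (C + 1) * (C + 36))))) :=
        Nat.mul_le_mul_left _ (Nat.mul_le_mul_left _ (Nat.mul_le_mul hA hB))

/-- The two positions of tower pair `i` differ (when seen in the final family). [folklore] -/
theorem tower_pos_ne {m H g : ℕ} (hH : 1 ≤ H) (i : Fin H) :
    (Fin.castAdd g (Fin.natAdd m (Fin.castAdd H i)) : Fin (m + (H + H) + g)) ≠ Fin.castAdd g (Fin.natAdd m (Fin.natAdd H i)) := by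
  intro h
  rw [Fin.ext_iff, Fin.val_castAdd, Fin.val_castAdd, Fin.val_natAdd, Fin.val_natAdd, Fin.val_castAdd, Fin.val_natAdd] at h
  omega

/-- Tower scales are `≥ 2`. [folklore] -/
theorem two_le_two_pow_succ (i : ℕ) : 2 ≤ 2 ^ (i + 1) :=
  calc (2 : ℕ) = 2 ^ 1 := (pow_one 2).symm
    _ ≤ 2 ^ (i + 1) := Nat.pow_le_pow_right (by norm_num) (by omega)

/-! ### The transfer -/

/-- **After R10 the residual is `PlanarCellBound`**: «v21 residual hypotheses + NOT confined-tame at level `C` ⇒ cells small» implies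
`PlanarCellBound` (texts verbatim; `(a, b) ↦ (a(18C+27), b + a(1152C+1216+18(C+1)(C+36)))`). [folklore] -/
theorem planarCellBound_of_residualNotTame (C : ℕ)
    (h : ∃ a b : ℕ, ∀ (m t : ℕ), 2 ≤ t → ∀ (u v : Fin m → MvPolynomial (Fin 2) ℂ),
      (∀ j, coeff 0 (u j) = 0 ∧ (u j).support.card ≤ t) → (∀ j, coeff 0 (v j) = 0 ∧ (v j).support.card ≤ t) →
      (∀ (J : Finset (Fin m)) (j₀ : Fin m), j₀ ∈ J →
        BlockSmall (fun j => (u j).support ∪ (v j).support) J (2 ^ m * (t + 2) ^ 4) →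
        ¬ PermType (mergeA (fun j => (u j).support ∪ (v j).support) J j₀)) →
      (∀ (r : ℕ) (Jc : Fin r → Finset (Fin m)) (ac bc : Fin r → Fin m → Expo),
        (∀ a ∈ tuples (fun j => (u j).support ∪ (v j).support), ∀ b ∈ tuples (fun j => (u j).support ∪ (v j).support),
          a ≠ b → ∑ j, a j = ∑ j, b j →
          ∃ k : Fin r, (∀ j, a j ≠ b j ↔ j ∈ Jc k) ∧
            ((∀ j ∈ Jc k, a j = ac k j ∧ b j = bc k j) ∨ (∀ j ∈ Jc k, a j = bc k j ∧ b j = ac k j))) →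
        2 ^ m * (t + 2) ^ 4 < 2 * (m + 1) * (3 * (2 + m + m.choose 2) ^ 2) ^ r) →
      (¬ ∃ ρp ρm : Expo →₀ ℕ, RankOneCoincidences (fun j => (u j).support ∪ (v j).support) ρp ρm) →
      (∀ L : Finset Expo, L.card ≤ C * m →
        (∀ a ∈ tuples (fun j => (u j).support ∪ (v j).support), ∀ b ∈ tuples (fun j => (u j).support ∪ (v j).support),
          ∑ j, a j = ∑ j, b j → ∀ e ∉ L, msetT a e = msetT b e) →
        ¬ (∀ a ∈ tuples (fun j => (u j).support ∪ (v j).support), ∀ y : Expo →₀ ℕ, y.support ⊆ L →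
            (∃ k : ℕ, 0 < k ∧ ((k : ℤ) • (Finsupp.mapRange (fun k : ℕ => (k : ℤ)) (by simp) y -
              Finsupp.mapRange (fun k : ℕ => (k : ℤ)) (by simp) ((msetT a).filter (· ∈ L)))) ∈
              Submodule.span ℤ {z : Expo →₀ ℤ | ∃ a ∈ tuples (fun j => (u j).support ∪ (v j).support),
                ∃ b ∈ tuples (fun j => (u j).support ∪ (v j).support), ∑ j, a j = ∑ j, b j ∧
                z = Finsupp.mapRange (fun k : ℕ => (k : ℤ)) (by simp) (msetT a) -
                  Finsupp.mapRange (fun k : ℕ => (k : ℤ)) (by simp) (msetT b)}) →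
            (y.sum fun _ k => k) ≤ (m + 2) ^ C)) →
      ∀ (R : Expo → Expo → Prop) (S : Finset Expo), IsCellFamily u v R S → S.card ≤ 2 ^ (a * m) * (t + 2) ^ b) :
    ∃ a b : ℕ, ∀ (m t : ℕ), 2 ≤ t → ∀ (u v : Fin m → MvPolynomial (Fin 2) ℂ),
      (∀ j, coeff 0 (u j) = 0 ∧ (u j).support.card ≤ t) → (∀ j, coeff 0 (v j) = 0 ∧ (v j).support.card ≤ t) →
      ∀ (R : Expo → Expo → Prop) (S : Finset Expo),
        (∀ l ∈ S, ∃ ξ : Fin 2 → ℝ, ValidWeight u v ξ ∧ IsStrictTop ξ (logSupport u v) l ∧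
          ∀ e ∈ ((Finset.univ.biUnion fun j => (u j).support) ∪ Finset.univ.biUnion fun j => (v j).support),
          ∀ e' ∈ ((Finset.univ.biUnion fun j => (u j).support) ∪ Finset.univ.biUnion fun j => (v j).support),
            (R e e' ↔ wt ξ e ≤ wt ξ e')) →
        S.card ≤ 2 ^ (a * m) * (t + 2) ^ b := by
  classical
  obtain ⟨a, b, h⟩ := h
  refine ⟨a * (18 * C + 27), b + a * (2 * (576 * C + 608) + 18 * (C + 1) * (C + 36)), fun m t ht u v hu hv R S hS => ?_⟩
  change IsCellFamily u v R S at hS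
  rcases S.eq_empty_or_nonempty with rfl | hne
  · simp
  have hT := tailSupport_nonempty_of_isCellFamily hS hne
  have hs0 := tailSum_ne_zero (fun j => (hu j).1) (fun j => (hv j).1) hT
  obtain ⟨Lg, hLg⟩ : ∃ Lg, Lg = Nat.log 2 (t + 2) := ⟨_, rfl⟩
  obtain ⟨z₀, hz₀⟩ : ∃ z₀, z₀ = m + 32 * (Lg + 1) + 36 + C := ⟨_, rfl⟩
  obtain ⟨H, hH⟩ : ∃ H, H = (C + 1) * z₀ := ⟨_, rfl⟩
  have hH1 : 1 ≤ H := by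
    have : 0 < (C + 1) * z₀ := Nat.mul_pos (Nat.succ_pos C) (by omega)
    omega
  have hlt : t + 2 < 2 ^ (Lg + 1) := by rw [hLg]; exact Nat.lt_pow_succ_log_self (by norm_num) _
  have hle : 2 ^ Lg ≤ t + 2 := by rw [hLg]; exact Nat.pow_log_le_self 2 (by omega)
  -- step 1: the common binary tower
  have hc2 : ∀ i : Fin H, 2 ≤ (fun i : Fin H => 2 ^ ((i : ℕ) + 1)) i := fun i => two_le_two_pow_succ i
  have hc0 : ∀ i : Fin H, (fun i : Fin H => 2 ^ ((i : ℕ) + 1)) i ≠ 0 := fun i => by have := hc2 i; simp only at this ⊢; omega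
  obtain ⟨y, hy⟩ : ∃ y : Fin H → MvPolynomial (Fin 2) ℂ, y = fun i : Fin H =>
      monomial ((fun i : Fin H => 2 ^ ((i : ℕ) + 1)) i • ∑ f ∈ tailSupport u v, f) (1 : ℂ) +
        monomial ((2 * (fun i : Fin H => 2 ^ ((i : ℕ) + 1)) i) • ∑ f ∈ tailSupport u v, f) 1 := ⟨_, rfl⟩
  obtain ⟨hu₁, hv₁, -, -, -, hcell₁⟩ := scaledPadding_spec ht _ hc2 u v hu hv hT y hy
  obtain ⟨R₁, hS₁⟩ := hcell₁ R S hS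
  have hlet := scaledPadding_letters (m := m) _ hc0 u v hs0 y hy
  obtain ⟨u₁, hu₁def⟩ : ∃ u₁ : Fin (m + (H + H)) → MvPolynomial (Fin 2) ℂ, u₁ = Fin.append u (Fin.append y y) := ⟨_, rfl⟩
  obtain ⟨v₁, hv₁def⟩ : ∃ v₁ : Fin (m + (H + H)) → MvPolynomial (Fin 2) ℂ, v₁ = Fin.append v (Fin.append y y) := ⟨_, rfl⟩
  rw [← hu₁def] at hu₁ hS₁ hlet
  rw [← hv₁def] at hv₁ hS₁ hlet
  have hT₁ := tailSupport_nonempty_of_isCellFamily hS₁ hne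
  have hs₁ := tailSum_ne_zero (fun j => (hu₁ j).1) (fun j => (hv₁ j).1) hT₁
  -- step 2: the full base-5 padding of the towered instance
  obtain ⟨k, hk⟩ : ∃ k, k = (m + (H + H)) + 4 * (Lg + 1) := ⟨_, rfl⟩
  have hC := fullPadding_condition hlt hk
  have hg2 : 2 ≤ 4 * k := by omega
  obtain ⟨z, hz⟩ : ∃ z : Fin (4 * k) → MvPolynomial (Fin 2) ℂ, z = fun i : Fin (4 * k) =>
      monomial ((2 * 5 ^ (i : ℕ)) • ∑ f ∈ tailSupport u₁ v₁, f) (1 : ℂ) +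
        monomial ((2 * (2 * 5 ^ (i : ℕ))) • ∑ f ∈ tailSupport u₁ v₁, f) 1 := ⟨_, rfl⟩
  obtain ⟨hu', hv', -, -, -, hcell'⟩ := fullPadding_spec ht u₁ v₁ hu₁ hv₁ hT₁ z hz
  obtain ⟨R', hS'⟩ := hcell' R₁ S hS₁
  have hnd := (fullPadding_noDatum u₁ v₁ hs₁ hg2 z hz).2
  -- the tower letters survive in the final family
  have hpq : ∀ i : Fin H, (Fin.castAdd (4 * k + 4 * k) (Fin.natAdd m (Fin.castAdd H i)) : Fin (m + (H + H) + (4 * k + 4 * k))) ≠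
      Fin.castAdd (4 * k + 4 * k) (Fin.natAdd m (Fin.natAdd H i)) := tower_pos_ne hH1
  have htw : ∀ i : Fin H,
      2 ^ ((i : ℕ) + 1) • ∑ f ∈ tailSupport u v, f ∈
        (Fin.append u₁ (Fin.append z z) (Fin.castAdd (4 * k + 4 * k) (Fin.natAdd m (Fin.castAdd H i)))).support ∪
          (Fin.append v₁ (Fin.append z z) (Fin.castAdd (4 * k + 4 * k) (Fin.natAdd m (Fin.castAdd H i)))).support ∧
      (2 * 2 ^ ((i : ℕ) + 1)) • ∑ f ∈ tailSupport u v, f ∈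
        (Fin.append u₁ (Fin.append z z) (Fin.castAdd (4 * k + 4 * k) (Fin.natAdd m (Fin.castAdd H i)))).support ∪
          (Fin.append v₁ (Fin.append z z) (Fin.castAdd (4 * k + 4 * k) (Fin.natAdd m (Fin.castAdd H i)))).support ∧
      2 ^ ((i : ℕ) + 1) • ∑ f ∈ tailSupport u v, f ∈
        (Fin.append u₁ (Fin.append z z) (Fin.castAdd (4 * k + 4 * k) (Fin.natAdd m (Fin.natAdd H i)))).support ∪
          (Fin.append v₁ (Fin.append z z) (Fin.castAdd (4 * k + 4 * k) (Fin.natAdd m (Fin.natAdd H i)))).support := by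
    intro i
    simp only [Fin.append_left]
    exact ⟨(hlet i).1.1, (hlet i).1.2, (hlet i).2.1⟩
  -- apply the law to the final instance
  exact (h (m + (H + H) + (4 * k + 4 * k)) t ht _ _ hu' hv'
    (fullPadding_noSmallPermMerge (t := t) _ hs₁ (fullPadding_letters u₁ v₁ hs₁ z hz) hC)
    (fullPadding_noCheapCover (t := t) _ hs₁ (fullPadding_letters u₁ v₁ hs₁ z hz) hC)
    (not_exists.2 fun ρp => not_exists.2 fun ρm => hnd ρp ρm)
    (fun L _ hLc => tower_not_fibreSpread _ hs0 _ _ hpq htw hH1 L hLc _ (tower_threshold hz₀ hH rfl hk))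
    R' S hS').trans (tower_cost a b hz₀ hH rfl hk hle (by omega))

/-- **The post-R10 residual and `PlanarCellBound` are equivalent** as `∃ a b` laws (for every level `C`). [folklore] -/
theorem residualNotTame_iff_planarCellBound (C : ℕ) :
    (∃ a b : ℕ, ∀ (m t : ℕ), 2 ≤ t → ∀ (u v : Fin m → MvPolynomial (Fin 2) ℂ),
      (∀ j, coeff 0 (u j) = 0 ∧ (u j).support.card ≤ t) → (∀ j, coeff 0 (v j) = 0 ∧ (v j).support.card ≤ t) →
      (∀ (J : Finset (Fin m)) (j₀ : Fin m), j₀ ∈ J →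
        BlockSmall (fun j => (u j).support ∪ (v j).support) J (2 ^ m * (t + 2) ^ 4) →
        ¬ PermType (mergeA (fun j => (u j).support ∪ (v j).support) J j₀)) →
      (∀ (r : ℕ) (Jc : Fin r → Finset (Fin m)) (ac bc : Fin r → Fin m → Expo),
        (∀ a ∈ tuples (fun j => (u j).support ∪ (v j).support), ∀ b ∈ tuples (fun j => (u j).support ∪ (v j).support),
          a ≠ b → ∑ j, a j = ∑ j, b j →
          ∃ k : Fin r, (∀ j, a j ≠ b j ↔ j ∈ Jc k) ∧
            ((∀ j ∈ Jc k, a j = ac k j ∧ b j = bc k j) ∨ (∀ j ∈ Jc k, a j = bc k j ∧ b j = ac k j))) →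
        2 ^ m * (t + 2) ^ 4 < 2 * (m + 1) * (3 * (2 + m + m.choose 2) ^ 2) ^ r) →
      (¬ ∃ ρp ρm : Expo →₀ ℕ, RankOneCoincidences (fun j => (u j).support ∪ (v j).support) ρp ρm) →
      (∀ L : Finset Expo, L.card ≤ C * m →
        (∀ a ∈ tuples (fun j => (u j).support ∪ (v j).support), ∀ b ∈ tuples (fun j => (u j).support ∪ (v j).support),
          ∑ j, a j = ∑ j, b j → ∀ e ∉ L, msetT a e = msetT b e) →
        ¬ (∀ a ∈ tuples (fun j => (u j).support ∪ (v j).support), ∀ y : Expo →₀ ℕ, y.support ⊆ L →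
            (∃ k : ℕ, 0 < k ∧ ((k : ℤ) • (Finsupp.mapRange (fun k : ℕ => (k : ℤ)) (by simp) y -
              Finsupp.mapRange (fun k : ℕ => (k : ℤ)) (by simp) ((msetT a).filter (· ∈ L)))) ∈
              Submodule.span ℤ {z : Expo →₀ ℤ | ∃ a ∈ tuples (fun j => (u j).support ∪ (v j).support),
                ∃ b ∈ tuples (fun j => (u j).support ∪ (v j).support), ∑ j, a j = ∑ j, b j ∧
                z = Finsupp.mapRange (fun k : ℕ => (k : ℤ)) (by simp) (msetT a) -
                  Finsupp.mapRange (fun k : ℕ => (k : ℤ)) (by simp) (msetT b)}) →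
            (y.sum fun _ k => k) ≤ (m + 2) ^ C)) →
      ∀ (R : Expo → Expo → Prop) (S : Finset Expo), IsCellFamily u v R S → S.card ≤ 2 ^ (a * m) * (t + 2) ^ b) ↔
    (∃ a b : ℕ, ∀ (m t : ℕ), 2 ≤ t → ∀ (u v : Fin m → MvPolynomial (Fin 2) ℂ),
      (∀ j, coeff 0 (u j) = 0 ∧ (u j).support.card ≤ t) → (∀ j, coeff 0 (v j) = 0 ∧ (v j).support.card ≤ t) →
      ∀ (R : Expo → Expo → Prop) (S : Finset Expo),
        (∀ l ∈ S, ∃ ξ : Fin 2 → ℝ, ValidWeight u v ξ ∧ IsStrictTop ξ (logSupport u v) l ∧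
          ∀ e ∈ ((Finset.univ.biUnion fun j => (u j).support) ∪ Finset.univ.biUnion fun j => (v j).support),
          ∀ e' ∈ ((Finset.univ.biUnion fun j => (u j).support) ∪ Finset.univ.biUnion fun j => (v j).support),
            (R e e' ↔ wt ξ e ≤ wt ξ e')) →
        S.card ≤ 2 ^ (a * m) * (t + 2) ^ b) :=
  ⟨planarCellBound_of_residualNotTame C, fun ⟨a, b, h⟩ =>
    ⟨a, b, fun m t ht u v hu hv _ _ _ _ R S hS => h m t ht u v hu hv R S hS⟩⟩

end Summit.ValiantsHypothesis.Theorems.TwoProducts.Negative.TowerPaddingResidual
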